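import Literature.MathematicalPhysics.KineticTheory.LangevinChainConfined
import Literature.MathematicalPhysics.KineticTheory.ReyBelletThomas2002ForwardEquation
import HarnessLib

/-!
# The Fokker–Planck (forward) equation of the Langevin chain in `𝓓'((0,∞) × Ω)`

Topic `Literature/MathematicalPhysics/KineticTheory`. Cuneo–Eckmann–Hairer–Rey-Bellet 2018,
Prop. 3.2 ("the transition probabilities `P_t(z, dz')` have a density `p_t(z, z')` … smooth …
well known [Hörmander 1967]") rests on the parabolic Hörmander theorem for `∂_t - L*` applied to the
forward Kolmogorov equation of the process. For the Langevin chain `P : OscillatorChain` on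
`PhaseSpace N` (generator `L = OscillatorChain.generator P N T_L T_R`, CEHR (3.2)) and every Markov
semigroup with Dynkin's identity for `L` — the interface `LangevinChainSemigroup P N T_L T_R` of
`LangevinSemigroup.lean`, here first repackaged as the generator-indexed interface
`MarkovSemigroupFor (P.generator N T_L T_R)` of `ReyBelletThomas2002.lean` on which the abstract
forward equation `MarkovSemigroupFor.forwardEquation` (`MarkovSemigroupForwardEquation.lean`) is
stated — this file proves the input of that abstract theorem, that `L` acts smoothly on smooth
compactly supported one-parameter families, exactly as `ReyBelletThomas2002ForwardEquation.lean`
does for the Rey-Bellet–Thomas model: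

* `LangevinChainSemigroup.toMarkovSemigroupFor` — the (field-by-field) repackaging;
* `OscillatorChain.generator_family_eq` — `L(Ψ(t,·))(y) = DΨ(t,y)·(0, Y(y)) + ½∑_b D[DΨ·(0,v_b)](t,y)·(0,v_b)`
  (Itô form of `L`, `sdeGenerator_drift_eq_generator`, read through the slices);
* `OscillatorChain.generator_actsOnFamilies` — `(t, y) ↦ L(Ψ(t,·))(y)` is `C_c^∞` for `Ψ ∈ C_c^∞`;
* `OscillatorChain.langevin_forwardEquation` — **the forward equation**: for every
  `S : MarkovSemigroupFor (P.generator N T_L T_R)`, every `x` and every `Ψ ∈ C_c^∞(ℝ × Ω)`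
  supported in `(0,∞) × Ω`, `∫₀^∞ ∫ (∂_tΨ + L_yΨ)(t, y) P_t(x, dy) dt = 0`.

Smooth potentials, `N ≥ 1`, `γT_L, γT_R ≥ 0`.

## References

* N. Cuneo, J.-P. Eckmann, M. Hairer, L. Rey-Bellet, EJP 23 (2018) no. 55, §3 eq. (3.2), Prop. 3.2.
* A. N. Kolmogorov, Math. Ann. 104 (1931) 415–458, §13.
-/

noncomputable section

open MeasureTheory ProbabilityTheory Filter Topology Set Function
open scoped NNReal ENNReal ContDiff

namespace Literature.MathematicalPhysics.KineticTheory.HeatConduction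

open Literature.MathematicalPhysics.KineticTheory

variable {N : ℕ}

/-! ### The Langevin semigroup as a `MarkovSemigroupFor` its generator -/

namespace LangevinChainSemigroup

variable {P : OscillatorChain} {T_L T_R : ℝ}

/-- A `LangevinChainSemigroup P N T_L T_R` IS a `MarkovSemigroupFor (P.generator N T_L T_R)`
(the two interfaces have literally the same fields; the second is indexed by the generator).
[folklore] -/
def toMarkovSemigroupFor (S : LangevinChainSemigroup P N T_L T_R) :
    MarkovSemigroupFor (P.generator N T_L T_R) where
  kernel := S.kernel
  isMarkovKernel := S.isMarkovKernel
  kernel_zero := S.kernel_zero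
  kernel_add := S.kernel_add
  measurable_kernel := S.measurable_kernel
  dynkin := S.dynkin

/-- The kernels are unchanged by the repackaging. [folklore] -/
@[simp] theorem toMarkovSemigroupFor_kernel (S : LangevinChainSemigroup P N T_L T_R) (t : ℝ≥0) :
    S.toMarkovSemigroupFor.kernel t = S.kernel t := rfl

/-- The action on observables is unchanged by the repackaging. [folklore] -/
@[simp] theorem toMarkovSemigroupFor_act (S : LangevinChainSemigroup P N T_L T_R) (t : ℝ≥0)
    (f : PhaseSpace N → ℝ) : S.toMarkovSemigroupFor.act t f = S.act t f := rfl

end LangevinChainSemigroup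

/-! ### The generator acts smoothly on smooth compactly supported families -/

namespace OscillatorChain

variable (P : OscillatorChain)

/-- **`L(Ψ(t,·))(y)` in terms of `Ψ` on `ℝ × Ω`**: for `N ≥ 1`, `γT_L, γT_R ≥ 0` and
`Ψ ∈ C^∞(ℝ × Ω)`,
`L(Ψ(t,·))(y) = DΨ(t,y)·(0, Y(y)) + ½ ∑_b D[q ↦ DΨ(q)·(0,v_b)](t,y)·(0,v_b)` with the Langevin drift
`Y = P.drift N` and the bath vectors `v_L = P.bathVecL N T_L`, `v_R = P.bathVecR N T_R` (Itô form of
`L`, `sdeGenerator_drift_eq_generator`, read through the slices).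
[cite: CuneoEckmannHairerReyBellet2018, §3 eq. (3.2)] -/
theorem generator_family_eq (hN : 0 < N) {T_L T_R : ℝ} (hL : 0 ≤ P.γ * T_L) (hR : 0 ≤ P.γ * T_R)
    {Ψ : ℝ × PhaseSpace N → ℝ} (hΨ : ContDiff ℝ ∞ Ψ) :
    (fun p : ℝ × PhaseSpace N => P.generator N T_L T_R (fun y => Ψ (p.1, y)) p.2) =
      fun p => fderiv ℝ Ψ p (0, P.drift N p.2) +
        (1 / 2) * (fderiv ℝ (fun q : ℝ × PhaseSpace N => fderiv ℝ Ψ q (0, P.bathVecL N T_L)) p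
            (0, P.bathVecL N T_L) +
          fderiv ℝ (fun q : ℝ × PhaseSpace N => fderiv ℝ Ψ q (0, P.bathVecR N T_R)) p
            (0, P.bathVecR N T_R)) := by
  funext p
  obtain ⟨t, y⟩ := p
  have hΨ2 : ContDiff ℝ 2 Ψ := hΨ.of_le (by norm_cast)
  have h2 : ContDiff ℝ 2 (fun y' => Ψ (t, y')) := hΨ2.comp (contDiff_const.prodMk contDiff_id)
  rw [← P.sdeGenerator_drift_eq_generator hN hL hR h2, sdeGenerator]
  simp only
  rw [fderiv_spaceSlice_apply (hΨ.differentiable (by simp)) t y,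
    fderiv_fderiv_spaceSlice_apply hΨ2 t y, fderiv_fderiv_spaceSlice_apply hΨ2 t y]

/-- **The generator `L` of the Langevin chain acts smoothly on smooth compactly supported
one-parameter families**: `(t, y) ↦ L(Ψ(t,·))(y)` is `C^∞` with compact support on `ℝ × Ω` for
every `Ψ ∈ C_c^∞(ℝ × Ω)` (smooth potentials, `N ≥ 1`, `γT_L, γT_R ≥ 0`) — the hypothesis of the
abstract forward equation `MarkovSemigroupFor.forwardEquation`. [folklore] -/
theorem generator_actsOnFamilies (hU : ContDiff ℝ ∞ P.U) (hV : ContDiff ℝ ∞ P.V) (hN : 0 < N)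
    {T_L T_R : ℝ} (hL : 0 ≤ P.γ * T_L) (hR : 0 ≤ P.γ * T_R) :
    ∀ Ψ : ℝ × PhaseSpace N → ℝ, ContDiff ℝ ∞ Ψ → HasCompactSupport Ψ →
      ContDiff ℝ ∞ (fun p : ℝ × PhaseSpace N => P.generator N T_L T_R (fun y => Ψ (p.1, y)) p.2) ∧
      HasCompactSupport (fun p : ℝ × PhaseSpace N =>
        P.generator N T_L T_R (fun y => Ψ (p.1, y)) p.2) := by
  intro Ψ hΨ hΨc
  rw [P.generator_family_eq hN hL hR hΨ]
  have hYs : ContDiff ℝ ∞ (P.drift N) := P.contDiff_drift hU hV N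
  have hD : ContDiff ℝ ∞ (fderiv ℝ Ψ) := hΨ.fderiv_right (m := ∞) (by exact_mod_cast le_top)
  have hA : ∀ v : PhaseSpace N, ContDiff ℝ ∞ (fun q : ℝ × PhaseSpace N => fderiv ℝ Ψ q (0, v)) :=
    fun v => hD.clm_apply contDiff_const
  have hA' : ∀ v : PhaseSpace N, ContDiff ℝ ∞ (fun p : ℝ × PhaseSpace N =>
      fderiv ℝ (fun q : ℝ × PhaseSpace N => fderiv ℝ Ψ q (0, v)) p (0, v)) := fun v =>
    ((hA v).fderiv_right (m := ∞) (by exact_mod_cast le_top)).clm_apply contDiff_const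
  have h1 : ContDiff ℝ ∞ (fun p : ℝ × PhaseSpace N => fderiv ℝ Ψ p (0, P.drift N p.2)) :=
    hD.clm_apply (contDiff_const.prodMk (hYs.comp contDiff_snd))
  refine ⟨h1.add (contDiff_const.mul ((hA' _).add (hA' _))), ?_⟩
  refine hΨc.mono' fun p hp => by_contra fun hnot => hp ?_
  have h0 : fderiv ℝ Ψ p = 0 := Function.notMem_support.1 fun h => hnot (support_fderiv_subset ℝ h)
  have hA0 : ∀ v : PhaseSpace N,
      fderiv ℝ (fun q : ℝ × PhaseSpace N => fderiv ℝ Ψ q (0, v)) p = 0 := fun v =>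
    Function.notMem_support.1 fun h =>
      hnot (tsupport_fderiv_apply_subset ℝ (0, v) (support_fderiv_subset ℝ h))
  simp [h0, hA0]

/-- **The forward (Fokker–Planck) equation of the Langevin chain in `𝓓'((0,∞) × Ω)`**: for smooth
potentials, `N ≥ 1`, `γT_L, γT_R ≥ 0`, every `S : MarkovSemigroupFor (P.generator N T_L T_R)` (in
particular the constructed transition semigroups, repackaged by
`LangevinChainSemigroup.toMarkovSemigroupFor`), every starting point `x` and every test function
`Ψ ∈ C_c^∞(ℝ × Ω)` supported in `(0, ∞) × Ω`:
`∫₀^∞ ∫ (∂_tΨ(t, y) + L_yΨ(t, y)) P_t(x, dy) dt = 0` — the equation to which CEHR Prop. 3.2 applies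
Hörmander's theorem for `∂_t - L*`. [cite: CuneoEckmannHairerReyBellet2018, Prop 3.2] -/
theorem langevin_forwardEquation (hU : ContDiff ℝ ∞ P.U) (hV : ContDiff ℝ ∞ P.V) (hN : 0 < N)
    {T_L T_R : ℝ} (hL : 0 ≤ P.γ * T_L) (hR : 0 ≤ P.γ * T_R)
    (S : MarkovSemigroupFor (P.generator N T_L T_R))
    {Ψ : ℝ × PhaseSpace N → ℝ} (hΨ : ContDiff ℝ ∞ Ψ) (hΨc : HasCompactSupport Ψ)
    (hΨ0 : tsupport Ψ ⊆ Set.Ioi (0 : ℝ) ×ˢ Set.univ) (x : PhaseSpace N) :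
    ∫ t in Set.Ioi (0 : ℝ), S.act t.toNNReal
      (fun y => fderiv ℝ Ψ (t, y) (1, 0) + P.generator N T_L T_R (fun y' => Ψ (t, y')) y) x = 0 :=
  S.forwardEquation (P.generator_actsOnFamilies hU hV hN hL hR) hΨ hΨc hΨ0 x

end OscillatorChain

end Literature.MathematicalPhysics.KineticTheory.HeatConduction
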